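import Literature.NumberTheory.Automorphic.UnitaryGroupTorusLineLatticeIntegrandTwo
import Literature.NumberTheory.Automorphic.UnitaryGroupHeisenbergLatticeCollapse
import Literature.NumberTheory.Automorphic.UnitaryGroupIwasawaIntegration
import Literature.NumberTheory.Automorphic.IdelicDyadicUnfolding
import Mathlib.MeasureTheory.Integral.Bochner.Set
import HarnessLib

/-!
# The `K`-average of the line lattice sum of the unipotent term of `U(J₂)` as a lattice sum over `F^*` of the line profile
(Rogawski, *Automorphic Representations of Unitary Groups in Three Variables* (1990), §7.3, proof of Prop. 7.3.1–7.3.2,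
(7.3.2)–(7.3.3), pp. 96–98: after `g = n m k` and the `K`-average `f^K`, the term is `∫_{ZM∖M} Σ_{t ∈ F^*} Φ(t · α(m)⁻¹)`; §2.2
p. 13 «the sums are finite»; for `G = U(2)`, `U(2) × U(1)` the computation is «as in the previous section» (p. 98).)

Topic `NumberTheory/Automorphic`; namespace `Literature.NumberTheory.Automorphic.UnitaryGroup`. THEOREMS ONLY over accepted
tree modules (no definition, no named fact, no instance, no notation, no `sorry`). H-side copy at `N = 2` (cell
`pub/hodgecm-mathlib`, crux H413, census `CENSUS-LAWS-Hside` §3 (σ-u), row (C-K)_two FILE 2 — the ANALYTIC HALF, sequel of ★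
`UnitaryGroupTorusLineLatticeIntegrandTwo`) of ★ (C-K) FILE 2 `UnitaryGroupTorusCentreLatticeKAverage` (A-p03 (g20), typed at
`N = 3` on the centre of the Heisenberg group). Letters as in FILE 1: `ζ`, `z₁` (`↑z₁ = toAdelic (z · 1)`), the chart
`n(b) = middleRootUnipotent hij hN (Multiplicative.ofAdd b)` of ★ H-B1, the `u`-sum `Σ'_{u ∈ N(F), u ≠ 1} f(g⁻¹ (z₁ u) g)` of the
bracket of ★ B1_two spelled INLINE (token for token), the line `θ = traceZeroLine F E c hcδ hδ`, the relative norm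
`N = AdeleRing.ideleRelNorm F E`, `d₀ t = diagUnit (↑t).2 0`; and `K = K_U = adelicVal⁻¹(K_∞ · GL₂(𝒪̂_E))` with a Haar measure
`μK` (verbatim as ★ (G-b) `exists_weight_iwasawa_kAverage (N := 2)` ∕ ★ (C-G)_two).

* §1 UNIFORM FINITENESS `finite_setOf_rationalUnipotent_exists_conj_mem_of_isCompact_two` ∕
  `exists_finset_forall_conj_rationalUnipotent_eq_zero_two`: on a compact set of conjugators only finitely many `u ∈ N(F) ∖ 1`
  bring `z₁ u` into a compact set (★ `finite_setOf_exists_inv_mul_mul_mem_of_isCompact`: `z₁ u ∈ G(F)`, `G(F)` discrete);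
  `measurable_tsum_rationalUnipotent_two`.
* §2 **`integral_tsum_rationalUnipotent_mul_eq_tsum_integral_two`**: for `f ∈ C_c(G(𝔸_F))`, `∫_K` and `Σ'_{u ≠ 1}` commute
  along `y K` (both sides one finite sum); `integrable_tsum_rationalUnipotent_mul_two` — the `u`-sum is `μK`-integrable along
  `y K` (so the head may split `∫_K ψ_T(t k) = ∫_K Σ − ∫_K tail`).
* §3 **`integral_tsum_line_torus_mul_eq_tsum_principalIdeles_two`**: for `E/F` quadratic,
  `∫_K Σ'_{u ≠ 1} f((t k)⁻¹ (z₁ u) (t k)) dμK = Σ'_{k ∈ F^*} Φ(k · N(d₀ t))` for every `Φ` agreeing with the LINE PROFILE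
  `y ↦ ∫_K f(k⁻¹ (z₁ n(θ(y⁻¹))) k) dμK` (= p08's ★ `lineKAverage…` `φ` read at the idele `y⁻¹`; ★ FILE 1
  `tsum_line_conj_torus_mul_eq_tsum_principalIdeles_two` at `g = 1`); the `[0, ∞]` twin with `≤` and no support hypothesis
  `lintegral_enorm_tsum_line_torus_mul_le_two`; `continuous_lineProfile_two` ∕ `measurable_lineProfile_two` (Mathlib
  `continuous_parametric_integral_of_continuous`). With ★ (C-G)_two, ★ B-p10 (C-P)_two
  `exists_push_and_integral_tsum_comp_ideleRelNorm_diagUnitZero_eq_two` ∕ `lineTorusStage_eq_…_two` and ★ (K4)_two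
  `δ_B(t) = ‖N(d₀ t)‖_F` these are the Σ-half inputs of the (σ-u) head's normal form `hΘ` (Tate's `Σf((N d₀ t)⁻¹)`).

HC_CM is proved only modulo the 7 printed citations until rung 0 closes — nothing here bears on a summit statement.

## References
* J. D. Rogawski, *Automorphic Representations of Unitary Groups in Three Variables*, Ann. of Math. Stud. 123 (1990),
  §2.2 (p. 13), §7.3 (7.3.2)–(7.3.3) and Prop. 7.3.1–7.3.2 (pp. 96–98) [Rogawski1990].
* S. Gelbart, *Automorphic Forms on Adele Groups*, Ann. of Math. Stud. 83 (1975), (9.20) [Gelbart1975].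
-/

set_option autoImplicit false

noncomputable section

open MeasureTheory Measure NumberField IsDedekindDomain Topology Set
open scoped MatrixGroups NNReal ENNReal

namespace Literature.NumberTheory.Automorphic

namespace UnitaryGroup

variable {F E : Type} [Field F] [NumberField F] [Field E] [NumberField E] [Algebra F E]
  {c : E ≃ₐ[F] E}
  (hij : (((0 : Fin 2) : Fin 2) : ℕ) + 1 = (((1 : Fin 2) : Fin 2) : ℕ)) (hN : 2 = 2 * (((0 : Fin 2) : Fin 2) : ℕ) + 2)

variable (ζ : ratOne F E c) {z₁ : (quasiSplit F E c 2).arithmeticSubgroup}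

section Plumbing

/-- `N(F) ∖ 1` is countable (`N(F)` injects into the countable `G(F)`). [folklore] -/
private theorem countable_rationalUnipotent_ne_one₂ : Countable {u : rationalUnipotent F E c 2 // u ≠ 1} := by
  haveI : Countable (rationalUnipotent F E c 2) := by
    haveI : Countable (quasiSplit F E c 2).arithmeticSubgroup := by
      haveI : Countable E := NumberField.countable' (K := E)
      haveI : Countable (Matrix (Fin 2) (Fin 2) E) := inferInstanceAs (Countable (Fin 2 → Fin 2 → E))
      haveI : Countable (GL (Fin 2) E) := Units.val_injective.countable
      haveI : Countable (quasiSplit F E c 2).Rational :=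
        inferInstanceAs (Countable (rational F E c 2 ((StdForm.antidiagonal 2).over E)))
      exact (Set.countable_range _).to_subtype
    have h1 : Function.Injective fun γ : rationalUnipotent F E c 2 =>
        (⟨((γ : adelicUnipotent F E c 2) : (quasiSplit F E c 2).Adelic), γ.2⟩ :
          (quasiSplit F E c 2).arithmeticSubgroup) := fun a a' h =>
      Subtype.ext (Subtype.ext (congrArg (fun γ : (quasiSplit F E c 2).arithmeticSubgroup =>
        (γ : (quasiSplit F E c 2).Adelic)) h))
    exact h1.countable
  exact Subtype.countable

/-- Conjugation by `t k` versus conjugation by `t · 1` followed by `k` (group plumbing). [folklore] -/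
private theorem conj_torus_mul_eq₂ (T X k : (quasiSplit F E c 2).Adelic) :
    (T * k)⁻¹ * X * (T * k) = k⁻¹ * ((T * 1)⁻¹ * X * (T * 1)) * k := by group

/-- `1⁻¹ X 1 = X` (group plumbing). [folklore] -/
private theorem one_inv_mul_mul_one₂ (X : (quasiSplit F E c 2).Adelic) : (1 : (quasiSplit F E c 2).Adelic)⁻¹ * X * 1 = X := by
  group

/-- `K_U` is a compact space (★ `isCompact_comap_adelicVal_standardMaximalCompactGL`). [folklore] -/
private theorem compactSpace_KU₂ : CompactSpace ((standardMaximalCompactGL 2 E).comap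
    (adelicVal F E c 2 ((StdForm.antidiagonal 2).over E)) : Subgroup (quasiSplit F E c 2).Adelic) :=
  isCompact_iff_compactSpace.1 isCompact_comap_adelicVal_standardMaximalCompactGL

end Plumbing

/-! ## §1 Measurability; uniform finiteness of the contributing lattice points -/

section Finite

/-- **Only finitely many `u ∈ N(F) ∖ 1` contribute on a compact set of conjugators**: for compact `C, K ⊆ G(𝔸_F)`, the set of
`u ≠ 1` in `N(F)` with `y⁻¹ (z₁ u) y ∈ K` for some `y ∈ C` is finite (`z₁ u ∈ G(F)`, ★ `finite_setOf_exists_inv_mul_mul_mem_of_isCompact`,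
and `u ↦ z₁ u` is injective). Rogawski (1990), §2.2 p. 13 «the sums are finite». [cite: Rogawski1990, §2.2 (p. 13)] [cite: Gelbart1975, (9.20)] -/
theorem finite_setOf_rationalUnipotent_exists_conj_mem_of_isCompact_two (z₁ : (quasiSplit F E c 2).arithmeticSubgroup)
    {C K : Set (quasiSplit F E c 2).Adelic} (hC : IsCompact C) (hK : IsCompact K) :
    {u : {u : rationalUnipotent F E c 2 // u ≠ 1} | ∃ y ∈ C,
      y⁻¹ * ((z₁ * ⟨(((u.1 : rationalUnipotent F E c 2) : adelicUnipotent F E c 2) : (quasiSplit F E c 2).Adelic),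
        (u.1 : rationalUnipotent F E c 2).2⟩ : (quasiSplit F E c 2).arithmeticSubgroup) : (quasiSplit F E c 2).Adelic) *
        y ∈ K}.Finite := by
  have hfin := finite_setOf_exists_inv_mul_mul_mem_of_isCompact (F := F) (E := E) (c := c) (N := 2) hC hK
  -- the injection `u ↦ z₁ · u ∈ G(F)`
  let ι : {u : rationalUnipotent F E c 2 // u ≠ 1} → (quasiSplit F E c 2).arithmeticSubgroup := fun u =>
    z₁ * ⟨(((u.1 : rationalUnipotent F E c 2) : adelicUnipotent F E c 2) : (quasiSplit F E c 2).Adelic),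
      (u.1 : rationalUnipotent F E c 2).2⟩
  have hinj : Set.InjOn ι (ι ⁻¹' {γ : (quasiSplit F E c 2).arithmeticSubgroup |
      ∃ y ∈ C, y⁻¹ * (γ : (quasiSplit F E c 2).Adelic) * y ∈ K}) := by
    intro u _ u' _ h
    have h' := mul_left_cancel h
    have h'' := congrArg (fun γ : (quasiSplit F E c 2).arithmeticSubgroup => (γ : (quasiSplit F E c 2).Adelic)) h'
    exact Subtype.ext (Subtype.ext (Subtype.ext h''))
  exact (hfin.preimage hinj).subset fun u hu => hu

/-- **Finitely many `u` on a compact**: for `φ` of compact support and compact `C ⊆ G(𝔸_F)` there is a finite `S ⊆ N(F) ∖ 1`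
off which `φ(y⁻¹ (z₁ u) y) = 0` for all `y ∈ C`. [cite: Rogawski1990, §2.2 (p. 13)] -/
theorem exists_finset_forall_conj_rationalUnipotent_eq_zero_two {V : Type*} [Zero V] [TopologicalSpace V]
    (z₁ : (quasiSplit F E c 2).arithmeticSubgroup)
    {φ : (quasiSplit F E c 2).Adelic → V} (hφ : HasCompactSupport φ) {C : Set (quasiSplit F E c 2).Adelic} (hC : IsCompact C) :
    ∃ S : Finset {u : rationalUnipotent F E c 2 // u ≠ 1}, ∀ y ∈ C, ∀ u : {u : rationalUnipotent F E c 2 // u ≠ 1}, u ∉ S →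
      φ (y⁻¹ * ((z₁ * ⟨(((u.1 : rationalUnipotent F E c 2) : adelicUnipotent F E c 2) : (quasiSplit F E c 2).Adelic),
        (u.1 : rationalUnipotent F E c 2).2⟩ : (quasiSplit F E c 2).arithmeticSubgroup) : (quasiSplit F E c 2).Adelic) * y) = 0 := by
  classical
  have hfin := finite_setOf_rationalUnipotent_exists_conj_mem_of_isCompact_two (F := F) (E := E) (c := c) z₁ hC hφ.isCompact
  refine ⟨hfin.toFinset, fun y hy u hu => ?_⟩
  by_contra hne
  exact hu (hfin.mem_toFinset.2 ⟨y, hy, subset_tsupport _ hne⟩)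

variable [MeasurableSpace (quasiSplit F E c 2).Adelic] [BorelSpace (quasiSplit F E c 2).Adelic]

/-- **Measurability of the `u`-sum** `g ↦ Σ'_{u ≠ 1} f(g⁻¹ (z₁ u) g)` for continuous `f` (countable sum of continuous
functions). [cite: Rogawski1990, §7.3 (pp. 96–98)] -/
theorem measurable_tsum_rationalUnipotent_two (z₁ : (quasiSplit F E c 2).arithmeticSubgroup)
    {f : (quasiSplit F E c 2).Adelic → ℂ} (hf : Continuous f) :
    Measurable fun g : (quasiSplit F E c 2).Adelic => ∑' u : {u : rationalUnipotent F E c 2 // u ≠ 1},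
      f (g⁻¹ * ((z₁ * ⟨(((u.1 : rationalUnipotent F E c 2) : adelicUnipotent F E c 2) : (quasiSplit F E c 2).Adelic),
        (u.1 : rationalUnipotent F E c 2).2⟩ : (quasiSplit F E c 2).arithmeticSubgroup) : (quasiSplit F E c 2).Adelic) * g) := by
  haveI := countable_rationalUnipotent_ne_one₂ (F := F) (E := E) (c := c)
  refine Measurable.tsum fun u => ?_
  exact (hf.comp ((continuous_id.inv.mul continuous_const).mul continuous_id)).measurable

end Finite

section IdeleSum

/-! ## §3a The `u`-sum along the torus as Tate's idele sum `Σφ((N d₀ t)⁻¹)` (B-p10's `hΘ` letters) -/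

/-- **B1_two's `u`-SUM ALONG THE TORUS IS TATE'S IDELE SUM AT `(N(d₀ t))⁻¹`**: for `E/F` quadratic (`c δ = -δ ≠ 0`), `t ∈ T(𝔸_F)`
of `U(J₂)`, `g ∈ G(𝔸_F)` and every `G : G(𝔸_F) → ℂ`,
`Σ'_{u ∈ N(F), u ≠ 1} G((t g)⁻¹ (z₁ u) (t g)) = ideleSum F (x ↦ G(g⁻¹ (z₁ n(θ x)) g)) (N(d₀ t))⁻¹`
(★ `Meyer.ideleSum F φ x = Σ'_{a ∈ F^×} φ(a · x)`; ★ FILE 1 `tsum_line_conj_torus_mul_eq_tsum_principalIdeles_two` re-indexed along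
`F^× ≅ principalIdeles F` ★ `principalIdelesEquiv` and `a ↦ a⁻¹`) — the orientation `x_t = (N_{E∕F} d₀ t)⁻¹` of ★ B-p10
`lineTorusStage_eq_mul_setIntegral_tateIntegrand_two`, no inversion left over. [cite: Rogawski1990, §7.3 (7.3.2) (pp. 96–98)]
[cite: Rogawski1990, §7.2 (7.2.3) (p. 94)] -/
theorem tsum_line_conj_torus_mul_eq_ideleSum_two [Algebra.IsQuadraticExtension F E] {δ : E} (hcδ : c δ = -δ) (hδ : δ ≠ 0)
    (hz₁ : (z₁ : (quasiSplit F E c 2).Adelic) =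
      (quasiSplit F E c 2).toAdelic (ratCenter F E c 2 ((StdForm.antidiagonal 2).over E) ζ))
    (G : (quasiSplit F E c 2).Adelic → ℂ) (t : torusInBorel F E c 2) (g : (quasiSplit F E c 2).Adelic) :
    (∑' u : {u : rationalUnipotent F E c 2 // u ≠ 1},
      G ((((t : borelAdelic F E c 2) : (quasiSplit F E c 2).Adelic) * g)⁻¹ *
        ((z₁ * ⟨(((u.1 : rationalUnipotent F E c 2) : adelicUnipotent F E c 2) : (quasiSplit F E c 2).Adelic),
          (u.1 : rationalUnipotent F E c 2).2⟩ : (quasiSplit F E c 2).arithmeticSubgroup) : (quasiSplit F E c 2).Adelic) *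
        ((((t : borelAdelic F E c 2) : (quasiSplit F E c 2).Adelic)) * g))) =
      Meyer.ideleSum F (fun x : AdeleRing (𝓞 F) F =>
        G (g⁻¹ * ((z₁ : (quasiSplit F E c 2).Adelic) *
          ((middleRootUnipotent hij hN (Multiplicative.ofAdd (traceZeroLine F E c hcδ hδ x)) :
            adelicUnipotent F E c 2) : (quasiSplit F E c 2).Adelic)) * g))
        (AdeleRing.ideleRelNorm F E (diagUnit (t : borelAdelic F E c 2).2 0))⁻¹ := by
  rw [tsum_line_conj_torus_mul_eq_tsum_principalIdeles_two hij hN ζ hcδ hδ hz₁ G t g]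
  unfold Meyer.ideleSum
  -- `F^* ≃ principalIdeles F`, composed with inversion
  let e' : Fˣ ≃ GaloisRepresentations.principalIdeles F := (Equiv.inv Fˣ).trans (principalIdelesEquiv F).toEquiv
  have he' : ∀ ξ : Fˣ, ((((e' ξ : GaloisRepresentations.principalIdeles F) •
      AdeleRing.ideleRelNorm F E (diagUnit (t : borelAdelic F E c 2).2 0))⁻¹ : (AdeleRing (𝓞 F) F)ˣ) : AdeleRing (𝓞 F) F) =
      algebraMap F (AdeleRing (𝓞 F) F) (ξ : F) *
        (((AdeleRing.ideleRelNorm F E (diagUnit (t : borelAdelic F E c 2).2 0))⁻¹ : (AdeleRing (𝓞 F) F)ˣ) :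
          AdeleRing (𝓞 F) F) := by
    intro ξ
    have h1 : ((e' ξ : GaloisRepresentations.principalIdeles F) : (AdeleRing (𝓞 F) F)ˣ) =
        GaloisRepresentations.principalIdele F ξ⁻¹ := rfl
    rw [Subgroup.smul_def, smul_eq_mul, h1, _root_.mul_inv_rev, ← map_inv (GaloisRepresentations.principalIdele F),
      inv_inv, Units.val_mul, mul_comm]
    rfl
  rw [← e'.tsum_eq]
  exact tsum_congr fun ξ => by rw [he']

end IdeleSum

/-! ## §2 `∫_K` and `Σ'_{u ≠ 1}` commute -/

section KAverage

variable [MeasurableSpace (quasiSplit F E c 2).Adelic] [BorelSpace (quasiSplit F E c 2).Adelic]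

variable (μK : Measure ((standardMaximalCompactGL 2 E).comap
    (adelicVal F E c 2 ((StdForm.antidiagonal 2).over E)) : Subgroup (quasiSplit F E c 2).Adelic)) [μK.IsHaarMeasure]

/-- **Each term and the whole `u`-sum are `μK`-integrable along `y K`** for `f ∈ C_c(G(𝔸_F))`: on the compact `y K` only
finitely many `u` contribute, each term continuous on the compact group `K` — so the (σ-u) head may split
`∫_K ψ_T(t k) dμK` into the `u`-sum part and the tail part. [cite: Rogawski1990, §2.2 (p. 13)] [cite: Rogawski1990, §7.3 (7.3.2)] -/
theorem integrable_tsum_rationalUnipotent_mul_two (z₁ : (quasiSplit F E c 2).arithmeticSubgroup)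
    {f : (quasiSplit F E c 2).Adelic → ℂ} (hfc : HasCompactSupport f) (hf : Continuous f) (y : (quasiSplit F E c 2).Adelic) :
    (∀ u : {u : rationalUnipotent F E c 2 // u ≠ 1}, Integrable (fun k : ((standardMaximalCompactGL 2 E).comap
      (adelicVal F E c 2 ((StdForm.antidiagonal 2).over E)) : Subgroup (quasiSplit F E c 2).Adelic) =>
      f ((y * (k : (quasiSplit F E c 2).Adelic))⁻¹ *
        ((z₁ * ⟨(((u.1 : rationalUnipotent F E c 2) : adelicUnipotent F E c 2) : (quasiSplit F E c 2).Adelic),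
          (u.1 : rationalUnipotent F E c 2).2⟩ : (quasiSplit F E c 2).arithmeticSubgroup) : (quasiSplit F E c 2).Adelic) *
        (y * (k : (quasiSplit F E c 2).Adelic)))) μK) ∧
    Integrable (fun k : ((standardMaximalCompactGL 2 E).comap
      (adelicVal F E c 2 ((StdForm.antidiagonal 2).over E)) : Subgroup (quasiSplit F E c 2).Adelic) =>
      ∑' u : {u : rationalUnipotent F E c 2 // u ≠ 1},
        f ((y * (k : (quasiSplit F E c 2).Adelic))⁻¹ *
          ((z₁ * ⟨(((u.1 : rationalUnipotent F E c 2) : adelicUnipotent F E c 2) : (quasiSplit F E c 2).Adelic),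
            (u.1 : rationalUnipotent F E c 2).2⟩ : (quasiSplit F E c 2).arithmeticSubgroup) : (quasiSplit F E c 2).Adelic) *
          (y * (k : (quasiSplit F E c 2).Adelic)))) μK := by
  haveI := compactSpace_KU₂ (F := F) (E := E) (c := c)
  haveI : IsFiniteMeasure μK := CompactSpace.isFiniteMeasure
  -- the compact set of conjugators `y K`
  have hC : IsCompact ((fun k : ((standardMaximalCompactGL 2 E).comap
      (adelicVal F E c 2 ((StdForm.antidiagonal 2).over E)) : Subgroup (quasiSplit F E c 2).Adelic) =>
        y * (k : (quasiSplit F E c 2).Adelic)) '' Set.univ) :=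
    isCompact_univ.image (continuous_const.mul continuous_subtype_val)
  obtain ⟨S, hS⟩ := exists_finset_forall_conj_rationalUnipotent_eq_zero_two (F := F) (E := E) (c := c) z₁ hfc hC
  have hzero : ∀ (k : ((standardMaximalCompactGL 2 E).comap
      (adelicVal F E c 2 ((StdForm.antidiagonal 2).over E)) : Subgroup (quasiSplit F E c 2).Adelic))
      (u : {u : rationalUnipotent F E c 2 // u ≠ 1}), u ∉ S →
      f ((y * (k : (quasiSplit F E c 2).Adelic))⁻¹ *
        ((z₁ * ⟨(((u.1 : rationalUnipotent F E c 2) : adelicUnipotent F E c 2) : (quasiSplit F E c 2).Adelic),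
          (u.1 : rationalUnipotent F E c 2).2⟩ : (quasiSplit F E c 2).arithmeticSubgroup) : (quasiSplit F E c 2).Adelic) *
        (y * (k : (quasiSplit F E c 2).Adelic))) = 0 :=
    fun k u hu => hS _ ⟨k, Set.mem_univ _, rfl⟩ u hu
  -- each term is integrable on the compact group `K`
  have hint : ∀ u : {u : rationalUnipotent F E c 2 // u ≠ 1}, Integrable (fun k : ((standardMaximalCompactGL 2 E).comap
      (adelicVal F E c 2 ((StdForm.antidiagonal 2).over E)) : Subgroup (quasiSplit F E c 2).Adelic) =>
      f ((y * (k : (quasiSplit F E c 2).Adelic))⁻¹ *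
        ((z₁ * ⟨(((u.1 : rationalUnipotent F E c 2) : adelicUnipotent F E c 2) : (quasiSplit F E c 2).Adelic),
          (u.1 : rationalUnipotent F E c 2).2⟩ : (quasiSplit F E c 2).arithmeticSubgroup) : (quasiSplit F E c 2).Adelic) *
        (y * (k : (quasiSplit F E c 2).Adelic)))) μK := by
    intro u
    have hcont : Continuous fun k : ((standardMaximalCompactGL 2 E).comap
        (adelicVal F E c 2 ((StdForm.antidiagonal 2).over E)) : Subgroup (quasiSplit F E c 2).Adelic) =>
        f ((y * (k : (quasiSplit F E c 2).Adelic))⁻¹ *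
          ((z₁ * ⟨(((u.1 : rationalUnipotent F E c 2) : adelicUnipotent F E c 2) : (quasiSplit F E c 2).Adelic),
            (u.1 : rationalUnipotent F E c 2).2⟩ : (quasiSplit F E c 2).arithmeticSubgroup) : (quasiSplit F E c 2).Adelic) *
          (y * (k : (quasiSplit F E c 2).Adelic))) :=
      hf.comp (((continuous_const.mul continuous_subtype_val).inv.mul continuous_const).mul
        (continuous_const.mul continuous_subtype_val))
    exact hcont.integrable_of_hasCompactSupport
      (IsCompact.of_isClosed_subset isCompact_univ (isClosed_tsupport _) (Set.subset_univ _))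
  have hL : ∀ k : ((standardMaximalCompactGL 2 E).comap
      (adelicVal F E c 2 ((StdForm.antidiagonal 2).over E)) : Subgroup (quasiSplit F E c 2).Adelic),
      (∑' u : {u : rationalUnipotent F E c 2 // u ≠ 1},
        f ((y * (k : (quasiSplit F E c 2).Adelic))⁻¹ *
          ((z₁ * ⟨(((u.1 : rationalUnipotent F E c 2) : adelicUnipotent F E c 2) : (quasiSplit F E c 2).Adelic),
            (u.1 : rationalUnipotent F E c 2).2⟩ : (quasiSplit F E c 2).arithmeticSubgroup) : (quasiSplit F E c 2).Adelic) *
          (y * (k : (quasiSplit F E c 2).Adelic)))) =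
      ∑ u ∈ S, f ((y * (k : (quasiSplit F E c 2).Adelic))⁻¹ *
          ((z₁ * ⟨(((u.1 : rationalUnipotent F E c 2) : adelicUnipotent F E c 2) : (quasiSplit F E c 2).Adelic),
            (u.1 : rationalUnipotent F E c 2).2⟩ : (quasiSplit F E c 2).arithmeticSubgroup) : (quasiSplit F E c 2).Adelic) *
          (y * (k : (quasiSplit F E c 2).Adelic))) :=
    fun k => tsum_eq_sum fun u hu => hzero k u hu
  refine ⟨hint, ?_⟩
  have hfun : (fun k : ((standardMaximalCompactGL 2 E).comap
      (adelicVal F E c 2 ((StdForm.antidiagonal 2).over E)) : Subgroup (quasiSplit F E c 2).Adelic) =>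
      ∑' u : {u : rationalUnipotent F E c 2 // u ≠ 1},
        f ((y * (k : (quasiSplit F E c 2).Adelic))⁻¹ *
          ((z₁ * ⟨(((u.1 : rationalUnipotent F E c 2) : adelicUnipotent F E c 2) : (quasiSplit F E c 2).Adelic),
            (u.1 : rationalUnipotent F E c 2).2⟩ : (quasiSplit F E c 2).arithmeticSubgroup) : (quasiSplit F E c 2).Adelic) *
          (y * (k : (quasiSplit F E c 2).Adelic)))) =
      fun k : ((standardMaximalCompactGL 2 E).comap
        (adelicVal F E c 2 ((StdForm.antidiagonal 2).over E)) : Subgroup (quasiSplit F E c 2).Adelic) =>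
        ∑ u ∈ S, f ((y * (k : (quasiSplit F E c 2).Adelic))⁻¹ *
          ((z₁ * ⟨(((u.1 : rationalUnipotent F E c 2) : adelicUnipotent F E c 2) : (quasiSplit F E c 2).Adelic),
            (u.1 : rationalUnipotent F E c 2).2⟩ : (quasiSplit F E c 2).arithmeticSubgroup) : (quasiSplit F E c 2).Adelic) *
          (y * (k : (quasiSplit F E c 2).Adelic))) := funext hL
  rw [hfun]
  exact integrable_finsetSum _ fun u _ => hint u

/-- **`∫_K` AND `Σ'_{u ≠ 1}` COMMUTE** for `f ∈ C_c(G(𝔸_F))`: at every `y ∈ G(𝔸_F)`,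
`∫_K Σ'_{u ≠ 1} f((y k)⁻¹ (z₁ u) (y k)) dμK = Σ'_{u ≠ 1} ∫_K f((y k)⁻¹ (z₁ u) (y k)) dμK` — on the compact `y K` only
finitely many `u` contribute (both sides are the same FINITE sum). [cite: Rogawski1990, §2.2 (p. 13)] [cite: Rogawski1990, §7.3 (7.3.2)] -/
theorem integral_tsum_rationalUnipotent_mul_eq_tsum_integral_two (z₁ : (quasiSplit F E c 2).arithmeticSubgroup)
    {f : (quasiSplit F E c 2).Adelic → ℂ} (hfc : HasCompactSupport f) (hf : Continuous f) (y : (quasiSplit F E c 2).Adelic) :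
    ∫ k, (∑' u : {u : rationalUnipotent F E c 2 // u ≠ 1},
      f ((y * (k : (quasiSplit F E c 2).Adelic))⁻¹ *
        ((z₁ * ⟨(((u.1 : rationalUnipotent F E c 2) : adelicUnipotent F E c 2) : (quasiSplit F E c 2).Adelic),
          (u.1 : rationalUnipotent F E c 2).2⟩ : (quasiSplit F E c 2).arithmeticSubgroup) : (quasiSplit F E c 2).Adelic) *
        (y * (k : (quasiSplit F E c 2).Adelic)))) ∂μK =
      ∑' u : {u : rationalUnipotent F E c 2 // u ≠ 1}, ∫ k,
        f ((y * (k : (quasiSplit F E c 2).Adelic))⁻¹ *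
          ((z₁ * ⟨(((u.1 : rationalUnipotent F E c 2) : adelicUnipotent F E c 2) : (quasiSplit F E c 2).Adelic),
            (u.1 : rationalUnipotent F E c 2).2⟩ : (quasiSplit F E c 2).arithmeticSubgroup) : (quasiSplit F E c 2).Adelic) *
          (y * (k : (quasiSplit F E c 2).Adelic))) ∂μK := by
  haveI := compactSpace_KU₂ (F := F) (E := E) (c := c)
  haveI : IsFiniteMeasure μK := CompactSpace.isFiniteMeasure
  -- the compact set of conjugators `y K`
  have hC : IsCompact ((fun k : ((standardMaximalCompactGL 2 E).comap
      (adelicVal F E c 2 ((StdForm.antidiagonal 2).over E)) : Subgroup (quasiSplit F E c 2).Adelic) =>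
        y * (k : (quasiSplit F E c 2).Adelic)) '' Set.univ) :=
    isCompact_univ.image (continuous_const.mul continuous_subtype_val)
  obtain ⟨S, hS⟩ := exists_finset_forall_conj_rationalUnipotent_eq_zero_two (F := F) (E := E) (c := c) z₁ hfc hC
  have hzero : ∀ (k : ((standardMaximalCompactGL 2 E).comap
      (adelicVal F E c 2 ((StdForm.antidiagonal 2).over E)) : Subgroup (quasiSplit F E c 2).Adelic))
      (u : {u : rationalUnipotent F E c 2 // u ≠ 1}), u ∉ S →
      f ((y * (k : (quasiSplit F E c 2).Adelic))⁻¹ *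
        ((z₁ * ⟨(((u.1 : rationalUnipotent F E c 2) : adelicUnipotent F E c 2) : (quasiSplit F E c 2).Adelic),
          (u.1 : rationalUnipotent F E c 2).2⟩ : (quasiSplit F E c 2).arithmeticSubgroup) : (quasiSplit F E c 2).Adelic) *
        (y * (k : (quasiSplit F E c 2).Adelic))) = 0 :=
    fun k u hu => hS _ ⟨k, Set.mem_univ _, rfl⟩ u hu
  have hint := (integrable_tsum_rationalUnipotent_mul_two (F := F) (E := E) (c := c) μK z₁ hfc hf y).1
  have hL : ∀ k : ((standardMaximalCompactGL 2 E).comap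
      (adelicVal F E c 2 ((StdForm.antidiagonal 2).over E)) : Subgroup (quasiSplit F E c 2).Adelic),
      (∑' u : {u : rationalUnipotent F E c 2 // u ≠ 1},
        f ((y * (k : (quasiSplit F E c 2).Adelic))⁻¹ *
          ((z₁ * ⟨(((u.1 : rationalUnipotent F E c 2) : adelicUnipotent F E c 2) : (quasiSplit F E c 2).Adelic),
            (u.1 : rationalUnipotent F E c 2).2⟩ : (quasiSplit F E c 2).arithmeticSubgroup) : (quasiSplit F E c 2).Adelic) *
          (y * (k : (quasiSplit F E c 2).Adelic)))) =
      ∑ u ∈ S, f ((y * (k : (quasiSplit F E c 2).Adelic))⁻¹ *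
          ((z₁ * ⟨(((u.1 : rationalUnipotent F E c 2) : adelicUnipotent F E c 2) : (quasiSplit F E c 2).Adelic),
            (u.1 : rationalUnipotent F E c 2).2⟩ : (quasiSplit F E c 2).arithmeticSubgroup) : (quasiSplit F E c 2).Adelic) *
          (y * (k : (quasiSplit F E c 2).Adelic))) :=
    fun k => tsum_eq_sum fun u hu => hzero k u hu
  simp_rw [hL]
  rw [integral_finsetSum _ fun u _ => hint u, tsum_eq_sum (s := S)]
  intro u hu
  simp only [hzero _ u hu, integral_zero]

/-! ## §3 The `K`-average as a lattice sum over `F^*` of the line profile -/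

variable [Algebra.IsQuadraticExtension F E] {δ : E}

/-- **THE `K`-AVERAGE OF THE `u`-SUM ALONG THE TORUS IS A LATTICE SUM OVER `F^*` OF THE LINE PROFILE**
[Rogawski1990, (7.3.2)–(7.3.3) and p. 98: after `g = n m k` and the `K`-average `f^K`, the term is
`∫_{ZM∖M} Σ_{t ∈ F^*} Φ(t · α(m)⁻¹)`, `α(m)⁻¹ = N(a)⁻¹`]: for `E/F` quadratic (`c δ = -δ ≠ 0`), `f ∈ C_c(G(𝔸_F))`, `t ∈ T(𝔸_F)`
of `U(J₂)` and every `Φ` agreeing with the LINE PROFILE `y ↦ ∫_K f(k⁻¹ (z₁ n(θ(y⁻¹))) k) dμK`,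

  `∫_K Σ'_{u ∈ N(F), u ≠ 1} f((t k)⁻¹ (z₁ u) (t k)) dμK(k) = Σ'_{k ∈ F^*} Φ(k · N(d₀ t))`

(★ `integral_tsum_rationalUnipotent_mul_eq_tsum_integral_two` + ★ FILE 1 `tsum_line_conj_torus_mul_eq_tsum_principalIdeles_two`).
The right side is the integrand ★ (C-P)_two `exists_push_and_integral_tsum_comp_ideleRelNorm_diagUnitZero_eq_two` pushes to
`C ∫_H Φ` and Tate's `Σf((N d₀ t)⁻¹)` reads. [cite: Rogawski1990, §7.3 (7.3.2)–(7.3.3) (pp. 96–98)] -/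
theorem integral_tsum_line_torus_mul_eq_tsum_principalIdeles_two (hcδ : c δ = -δ) (hδ : δ ≠ 0)
    (hz₁ : (z₁ : (quasiSplit F E c 2).Adelic) =
      (quasiSplit F E c 2).toAdelic (ratCenter F E c 2 ((StdForm.antidiagonal 2).over E) ζ))
    {f : (quasiSplit F E c 2).Adelic → ℂ} (hfc : HasCompactSupport f) (hf : Continuous f) (t : torusInBorel F E c 2)
    (Φ : (AdeleRing (𝓞 F) F)ˣ → ℂ)
    (hΦ : ∀ y : (AdeleRing (𝓞 F) F)ˣ, Φ y = ∫ k, f ((k : (quasiSplit F E c 2).Adelic)⁻¹ *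
      ((z₁ : (quasiSplit F E c 2).Adelic) *
        ((middleRootUnipotent hij hN (Multiplicative.ofAdd
            (traceZeroLine F E c hcδ hδ (((y⁻¹ : (AdeleRing (𝓞 F) F)ˣ)) : AdeleRing (𝓞 F) F))) :
          adelicUnipotent F E c 2) : (quasiSplit F E c 2).Adelic)) * (k : (quasiSplit F E c 2).Adelic)) ∂μK) :
    ∫ k, (∑' u : {u : rationalUnipotent F E c 2 // u ≠ 1},
      f (((((t : borelAdelic F E c 2) : (quasiSplit F E c 2).Adelic)) * (k : (quasiSplit F E c 2).Adelic))⁻¹ *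
        ((z₁ * ⟨(((u.1 : rationalUnipotent F E c 2) : adelicUnipotent F E c 2) : (quasiSplit F E c 2).Adelic),
          (u.1 : rationalUnipotent F E c 2).2⟩ : (quasiSplit F E c 2).arithmeticSubgroup) : (quasiSplit F E c 2).Adelic) *
        ((((t : borelAdelic F E c 2) : (quasiSplit F E c 2).Adelic)) * (k : (quasiSplit F E c 2).Adelic)))) ∂μK =
      ∑' k : GaloisRepresentations.principalIdeles F,
        Φ (k • AdeleRing.ideleRelNorm F E (diagUnit (t : borelAdelic F E c 2).2 0)) := by
  rw [integral_tsum_rationalUnipotent_mul_eq_tsum_integral_two μK z₁ hfc hf]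
  -- the `K`-average as a function of the conjugated point
  set G : (quasiSplit F E c 2).Adelic → ℂ := fun X =>
    ∫ k, f ((k : (quasiSplit F E c 2).Adelic)⁻¹ * X * (k : (quasiSplit F E c 2).Adelic)) ∂μK with hG
  have key := tsum_line_conj_torus_mul_eq_tsum_principalIdeles_two hij hN ζ hcδ hδ hz₁ G t 1
  calc (∑' u : {u : rationalUnipotent F E c 2 // u ≠ 1}, ∫ k,
        f (((((t : borelAdelic F E c 2) : (quasiSplit F E c 2).Adelic)) * (k : (quasiSplit F E c 2).Adelic))⁻¹ *
          ((z₁ * ⟨(((u.1 : rationalUnipotent F E c 2) : adelicUnipotent F E c 2) : (quasiSplit F E c 2).Adelic),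
            (u.1 : rationalUnipotent F E c 2).2⟩ : (quasiSplit F E c 2).arithmeticSubgroup) : (quasiSplit F E c 2).Adelic) *
          ((((t : borelAdelic F E c 2) : (quasiSplit F E c 2).Adelic)) * (k : (quasiSplit F E c 2).Adelic))) ∂μK)
      = ∑' u : {u : rationalUnipotent F E c 2 // u ≠ 1},
          G (((((t : borelAdelic F E c 2) : (quasiSplit F E c 2).Adelic)) * 1)⁻¹ *
            ((z₁ * ⟨(((u.1 : rationalUnipotent F E c 2) : adelicUnipotent F E c 2) : (quasiSplit F E c 2).Adelic),
              (u.1 : rationalUnipotent F E c 2).2⟩ : (quasiSplit F E c 2).arithmeticSubgroup) : (quasiSplit F E c 2).Adelic) *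
            ((((t : borelAdelic F E c 2) : (quasiSplit F E c 2).Adelic)) * 1)) := by
        refine tsum_congr fun u => ?_
        simp only [hG]
        exact integral_congr_ae (ae_of_all _ fun k => congrArg f (conj_torus_mul_eq₂ _ _ _))
    _ = _ := key
    _ = ∑' k : GaloisRepresentations.principalIdeles F,
          Φ (k • AdeleRing.ideleRelNorm F E (diagUnit (t : borelAdelic F E c 2).2 0)) := by
        refine tsum_congr fun k => ?_
        rw [hΦ, hG]
        simp only
        exact integral_congr_ae (ae_of_all _ fun k => congrArg f (by rw [one_inv_mul_mul_one₂]))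

/-- **THE `K`-AVERAGE OF THE `u`-SUM ALONG THE TORUS IS TATE'S IDELE SUM OF THE LINE PROFILE AT `(N(d₀ t))⁻¹`** — the
Σ-half of the (σ-u) head's normal form `hΘ` in the letters of ★ B-p10 `lineTorusStage_eq_mul_setIntegral_tateIntegrand_two`
(`ideleSum F φ (N(d₀ t))⁻¹`): for `E/F` quadratic, `f ∈ C_c(G(𝔸_F))`, `t ∈ T(𝔸_F)` of `U(J₂)` and every `φ : 𝔸_F → ℂ` agreeing with
the LINE PROFILE `x ↦ ∫_K f(k⁻¹ (z₁ n(θ x)) k) dμK` (★ p08 `lineKAverage_mem_schwartzBruhatAdele_two`: `φ ∈ 𝒮(𝔸_F)`),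
`∫_K Σ'_{u ∈ N(F), u ≠ 1} f((t k)⁻¹ (z₁ u) (t k)) dμK = Σφ((N(d₀ t))⁻¹)`. [cite: Rogawski1990, §7.3 (7.3.2)–(7.3.3) (pp. 96–98)]
[cite: Rogawski1990, §7.2 (7.2.3) (p. 94)] -/
theorem integral_tsum_line_torus_mul_eq_ideleSum_two (hcδ : c δ = -δ) (hδ : δ ≠ 0)
    (hz₁ : (z₁ : (quasiSplit F E c 2).Adelic) =
      (quasiSplit F E c 2).toAdelic (ratCenter F E c 2 ((StdForm.antidiagonal 2).over E) ζ))
    {f : (quasiSplit F E c 2).Adelic → ℂ} (hfc : HasCompactSupport f) (hf : Continuous f) (t : torusInBorel F E c 2)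
    (φ : AdeleRing (𝓞 F) F → ℂ)
    (hφ : ∀ x : AdeleRing (𝓞 F) F, φ x = ∫ k, f ((k : (quasiSplit F E c 2).Adelic)⁻¹ *
      ((z₁ : (quasiSplit F E c 2).Adelic) *
        ((middleRootUnipotent hij hN (Multiplicative.ofAdd (traceZeroLine F E c hcδ hδ x)) :
          adelicUnipotent F E c 2) : (quasiSplit F E c 2).Adelic)) * (k : (quasiSplit F E c 2).Adelic)) ∂μK) :
    ∫ k, (∑' u : {u : rationalUnipotent F E c 2 // u ≠ 1},
      f (((((t : borelAdelic F E c 2) : (quasiSplit F E c 2).Adelic)) * (k : (quasiSplit F E c 2).Adelic))⁻¹ *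
        ((z₁ * ⟨(((u.1 : rationalUnipotent F E c 2) : adelicUnipotent F E c 2) : (quasiSplit F E c 2).Adelic),
          (u.1 : rationalUnipotent F E c 2).2⟩ : (quasiSplit F E c 2).arithmeticSubgroup) : (quasiSplit F E c 2).Adelic) *
        ((((t : borelAdelic F E c 2) : (quasiSplit F E c 2).Adelic)) * (k : (quasiSplit F E c 2).Adelic)))) ∂μK =
      Meyer.ideleSum F φ (AdeleRing.ideleRelNorm F E (diagUnit (t : borelAdelic F E c 2).2 0))⁻¹ := by
  rw [integral_tsum_rationalUnipotent_mul_eq_tsum_integral_two μK z₁ hfc hf]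
  -- the `K`-average as a function of the conjugated point
  set G : (quasiSplit F E c 2).Adelic → ℂ := fun X =>
    ∫ k, f ((k : (quasiSplit F E c 2).Adelic)⁻¹ * X * (k : (quasiSplit F E c 2).Adelic)) ∂μK with hG
  have key := tsum_line_conj_torus_mul_eq_ideleSum_two hij hN ζ hcδ hδ hz₁ G t 1
  have hφG : φ = fun x : AdeleRing (𝓞 F) F =>
      G ((1 : (quasiSplit F E c 2).Adelic)⁻¹ * ((z₁ : (quasiSplit F E c 2).Adelic) *
        ((middleRootUnipotent hij hN (Multiplicative.ofAdd (traceZeroLine F E c hcδ hδ x)) :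
          adelicUnipotent F E c 2) : (quasiSplit F E c 2).Adelic)) * 1) := by
    funext x
    rw [hφ, hG]
    simp only
    exact integral_congr_ae (ae_of_all _ fun k => congrArg f (by rw [one_inv_mul_mul_one₂]))
  calc (∑' u : {u : rationalUnipotent F E c 2 // u ≠ 1}, ∫ k,
        f (((((t : borelAdelic F E c 2) : (quasiSplit F E c 2).Adelic)) * (k : (quasiSplit F E c 2).Adelic))⁻¹ *
          ((z₁ * ⟨(((u.1 : rationalUnipotent F E c 2) : adelicUnipotent F E c 2) : (quasiSplit F E c 2).Adelic),
            (u.1 : rationalUnipotent F E c 2).2⟩ : (quasiSplit F E c 2).arithmeticSubgroup) : (quasiSplit F E c 2).Adelic) *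
          ((((t : borelAdelic F E c 2) : (quasiSplit F E c 2).Adelic)) * (k : (quasiSplit F E c 2).Adelic))) ∂μK)
      = ∑' u : {u : rationalUnipotent F E c 2 // u ≠ 1},
          G (((((t : borelAdelic F E c 2) : (quasiSplit F E c 2).Adelic)) * 1)⁻¹ *
            ((z₁ * ⟨(((u.1 : rationalUnipotent F E c 2) : adelicUnipotent F E c 2) : (quasiSplit F E c 2).Adelic),
              (u.1 : rationalUnipotent F E c 2).2⟩ : (quasiSplit F E c 2).arithmeticSubgroup) : (quasiSplit F E c 2).Adelic) *
            ((((t : borelAdelic F E c 2) : (quasiSplit F E c 2).Adelic)) * 1)) := by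
        refine tsum_congr fun u => ?_
        simp only [hG]
        exact integral_congr_ae (ae_of_all _ fun k => congrArg f (conj_torus_mul_eq₂ _ _ _))
    _ = _ := key
    _ = Meyer.ideleSum F φ (AdeleRing.ideleRelNorm F E (diagUnit (t : borelAdelic F E c 2).2 0))⁻¹ := by
        rw [hφG]

omit [μK.IsHaarMeasure] in
/-- **THE `[0, ∞]` TWIN (no support hypothesis, `≤`)**: for continuous `f`, `t ∈ T(𝔸_F)` of `U(J₂)` and every `Φ'` agreeing
with `y ↦ ∫⁻_K ‖f(k⁻¹ (z₁ n(θ(y⁻¹))) k)‖ dμK`,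
`∫⁻_K ‖Σ'_{u ≠ 1} f((t k)⁻¹ (z₁ u) (t k))‖ dμK ≤ Σ'_{k ∈ F^*} Φ'(k · N(d₀ t))`
(`‖Σ'‖ ≤ Σ'‖·‖`, Tonelli `lintegral_tsum`, ★ FILE 1 `tsum_line_conj_torus_mul_eq_tsum_principalIdeles_two`) — the majorant
shape of ★ (C-G)_two (L) ∕ ★ B-p10 `exists_lintegral_comp_ideleRelNorm_diagUnitZero_mul_weight_eq_setLIntegral_two`.
[cite: Rogawski1990, §7.3 (pp. 96–98)] -/
theorem lintegral_enorm_tsum_line_torus_mul_le_two (hcδ : c δ = -δ) (hδ : δ ≠ 0)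
    (hz₁ : (z₁ : (quasiSplit F E c 2).Adelic) =
      (quasiSplit F E c 2).toAdelic (ratCenter F E c 2 ((StdForm.antidiagonal 2).over E) ζ))
    {f : (quasiSplit F E c 2).Adelic → ℂ} (hf : Continuous f) (t : torusInBorel F E c 2)
    (Φ' : (AdeleRing (𝓞 F) F)ˣ → ℝ≥0∞)
    (hΦ' : ∀ y : (AdeleRing (𝓞 F) F)ˣ, Φ' y = ∫⁻ k, ‖f ((k : (quasiSplit F E c 2).Adelic)⁻¹ *
      ((z₁ : (quasiSplit F E c 2).Adelic) *
        ((middleRootUnipotent hij hN (Multiplicative.ofAdd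
            (traceZeroLine F E c hcδ hδ (((y⁻¹ : (AdeleRing (𝓞 F) F)ˣ)) : AdeleRing (𝓞 F) F))) :
          adelicUnipotent F E c 2) : (quasiSplit F E c 2).Adelic)) * (k : (quasiSplit F E c 2).Adelic))‖ₑ ∂μK) :
    ∫⁻ k, ‖∑' u : {u : rationalUnipotent F E c 2 // u ≠ 1},
      f (((((t : borelAdelic F E c 2) : (quasiSplit F E c 2).Adelic)) * (k : (quasiSplit F E c 2).Adelic))⁻¹ *
        ((z₁ * ⟨(((u.1 : rationalUnipotent F E c 2) : adelicUnipotent F E c 2) : (quasiSplit F E c 2).Adelic),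
          (u.1 : rationalUnipotent F E c 2).2⟩ : (quasiSplit F E c 2).arithmeticSubgroup) : (quasiSplit F E c 2).Adelic) *
        ((((t : borelAdelic F E c 2) : (quasiSplit F E c 2).Adelic)) * (k : (quasiSplit F E c 2).Adelic)))‖ₑ ∂μK ≤
      ∑' k : GaloisRepresentations.principalIdeles F,
        Φ' (k • AdeleRing.ideleRelNorm F E (diagUnit (t : borelAdelic F E c 2).2 0)) := by
  haveI := countable_rationalUnipotent_ne_one₂ (F := F) (E := E) (c := c)
  set G : (quasiSplit F E c 2).Adelic → ℝ≥0∞ := fun X =>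
    ∫⁻ k, ‖f ((k : (quasiSplit F E c 2).Adelic)⁻¹ * X * (k : (quasiSplit F E c 2).Adelic))‖ₑ ∂μK with hG
  have key := tsum_line_conj_torus_mul_eq_tsum_principalIdeles_two hij hN ζ hcδ hδ hz₁ G t 1
  have hmeas : ∀ u : {u : rationalUnipotent F E c 2 // u ≠ 1}, Measurable fun k : ((standardMaximalCompactGL 2 E).comap
      (adelicVal F E c 2 ((StdForm.antidiagonal 2).over E)) : Subgroup (quasiSplit F E c 2).Adelic) =>
      ‖f (((((t : borelAdelic F E c 2) : (quasiSplit F E c 2).Adelic)) * (k : (quasiSplit F E c 2).Adelic))⁻¹ *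
        ((z₁ * ⟨(((u.1 : rationalUnipotent F E c 2) : adelicUnipotent F E c 2) : (quasiSplit F E c 2).Adelic),
          (u.1 : rationalUnipotent F E c 2).2⟩ : (quasiSplit F E c 2).arithmeticSubgroup) : (quasiSplit F E c 2).Adelic) *
        ((((t : borelAdelic F E c 2) : (quasiSplit F E c 2).Adelic)) * (k : (quasiSplit F E c 2).Adelic)))‖ₑ :=
    fun u => (hf.comp (((continuous_const.mul continuous_subtype_val).inv.mul continuous_const).mul
      (continuous_const.mul continuous_subtype_val))).measurable.enorm
  calc ∫⁻ k, ‖∑' u : {u : rationalUnipotent F E c 2 // u ≠ 1},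
        f (((((t : borelAdelic F E c 2) : (quasiSplit F E c 2).Adelic)) * (k : (quasiSplit F E c 2).Adelic))⁻¹ *
          ((z₁ * ⟨(((u.1 : rationalUnipotent F E c 2) : adelicUnipotent F E c 2) : (quasiSplit F E c 2).Adelic),
            (u.1 : rationalUnipotent F E c 2).2⟩ : (quasiSplit F E c 2).arithmeticSubgroup) : (quasiSplit F E c 2).Adelic) *
          ((((t : borelAdelic F E c 2) : (quasiSplit F E c 2).Adelic)) * (k : (quasiSplit F E c 2).Adelic)))‖ₑ ∂μK
      ≤ ∫⁻ k, ∑' u : {u : rationalUnipotent F E c 2 // u ≠ 1},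
          ‖f (((((t : borelAdelic F E c 2) : (quasiSplit F E c 2).Adelic)) * (k : (quasiSplit F E c 2).Adelic))⁻¹ *
            ((z₁ * ⟨(((u.1 : rationalUnipotent F E c 2) : adelicUnipotent F E c 2) : (quasiSplit F E c 2).Adelic),
              (u.1 : rationalUnipotent F E c 2).2⟩ : (quasiSplit F E c 2).arithmeticSubgroup) : (quasiSplit F E c 2).Adelic) *
            ((((t : borelAdelic F E c 2) : (quasiSplit F E c 2).Adelic)) * (k : (quasiSplit F E c 2).Adelic)))‖ₑ ∂μK :=
        lintegral_mono fun k => enorm_tsum_le_tsum_enorm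
    _ = ∑' u : {u : rationalUnipotent F E c 2 // u ≠ 1}, ∫⁻ k,
          ‖f (((((t : borelAdelic F E c 2) : (quasiSplit F E c 2).Adelic)) * (k : (quasiSplit F E c 2).Adelic))⁻¹ *
            ((z₁ * ⟨(((u.1 : rationalUnipotent F E c 2) : adelicUnipotent F E c 2) : (quasiSplit F E c 2).Adelic),
              (u.1 : rationalUnipotent F E c 2).2⟩ : (quasiSplit F E c 2).arithmeticSubgroup) : (quasiSplit F E c 2).Adelic) *
            ((((t : borelAdelic F E c 2) : (quasiSplit F E c 2).Adelic)) * (k : (quasiSplit F E c 2).Adelic)))‖ₑ ∂μK :=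
        lintegral_tsum fun u => (hmeas u).aemeasurable
    _ = ∑' u : {u : rationalUnipotent F E c 2 // u ≠ 1},
          G (((((t : borelAdelic F E c 2) : (quasiSplit F E c 2).Adelic)) * 1)⁻¹ *
            ((z₁ * ⟨(((u.1 : rationalUnipotent F E c 2) : adelicUnipotent F E c 2) : (quasiSplit F E c 2).Adelic),
              (u.1 : rationalUnipotent F E c 2).2⟩ : (quasiSplit F E c 2).arithmeticSubgroup) : (quasiSplit F E c 2).Adelic) *
            ((((t : borelAdelic F E c 2) : (quasiSplit F E c 2).Adelic)) * 1)) := by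
        refine tsum_congr fun u => ?_
        simp only [hG]
        exact lintegral_congr fun k => by rw [conj_torus_mul_eq₂]
    _ = _ := key
    _ = ∑' k : GaloisRepresentations.principalIdeles F,
          Φ' (k • AdeleRing.ideleRelNorm F E (diagUnit (t : borelAdelic F E c 2).2 0)) := by
        refine tsum_congr fun k => ?_
        rw [hΦ', hG]
        simp only
        exact lintegral_congr fun k => by rw [one_inv_mul_mul_one₂]

/-- **The line profile is continuous**: `y ↦ ∫_K f(k⁻¹ (z₁ n(θ(y⁻¹))) k) dμK` is continuous on `𝕀_F` for continuous `f` (jointly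
continuous integrand on the compact `K`; Mathlib `continuous_parametric_integral_of_continuous`).
[cite: Rogawski1990, §7.3 (pp. 96–98)] -/
theorem continuous_lineProfile_two (hcδ : c δ = -δ) (hδ : δ ≠ 0) (z₁ : (quasiSplit F E c 2).arithmeticSubgroup)
    {f : (quasiSplit F E c 2).Adelic → ℂ} (hf : Continuous f) :
    Continuous fun y : (AdeleRing (𝓞 F) F)ˣ => ∫ k, f ((k : (quasiSplit F E c 2).Adelic)⁻¹ *
      ((z₁ : (quasiSplit F E c 2).Adelic) *
        ((middleRootUnipotent hij hN (Multiplicative.ofAdd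
            (traceZeroLine F E c hcδ hδ (((y⁻¹ : (AdeleRing (𝓞 F) F)ˣ)) : AdeleRing (𝓞 F) F))) :
          adelicUnipotent F E c 2) : (quasiSplit F E c 2).Adelic)) * (k : (quasiSplit F E c 2).Adelic)) ∂μK := by
  haveI := compactSpace_KU₂ (F := F) (E := E) (c := c)
  haveI : IsFiniteMeasure μK := CompactSpace.isFiniteMeasure
  haveI := secondCountableTopology_ideleGroup F
  haveI := locallyCompactSpace_ideleGroup F
  have hcont : Continuous (Function.uncurry fun (y : (AdeleRing (𝓞 F) F)ˣ)
      (k : ((standardMaximalCompactGL 2 E).comap (adelicVal F E c 2 ((StdForm.antidiagonal 2).over E)) :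
        Subgroup (quasiSplit F E c 2).Adelic)) =>
      f ((k : (quasiSplit F E c 2).Adelic)⁻¹ *
        ((z₁ : (quasiSplit F E c 2).Adelic) *
          ((middleRootUnipotent hij hN (Multiplicative.ofAdd
              (traceZeroLine F E c hcδ hδ (((y⁻¹ : (AdeleRing (𝓞 F) F)ˣ)) : AdeleRing (𝓞 F) F))) :
            adelicUnipotent F E c 2) : (quasiSplit F E c 2).Adelic)) * (k : (quasiSplit F E c 2).Adelic))) := by
    have hθ : Continuous fun y : (AdeleRing (𝓞 F) F)ˣ =>
        ((middleRootUnipotent hij hN (Multiplicative.ofAdd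
            (traceZeroLine F E c hcδ hδ (((y⁻¹ : (AdeleRing (𝓞 F) F)ˣ)) : AdeleRing (𝓞 F) F))) :
          adelicUnipotent F E c 2) : (quasiSplit F E c 2).Adelic) :=
      continuous_subtype_val.comp ((continuous_middleRootUnipotent_two hij hN).comp
        ((traceZeroLine F E c hcδ hδ).continuous.comp (Units.continuous_val.comp continuous_inv)))
    exact hf.comp ((((continuous_subtype_val.comp continuous_snd).inv).mul
      (continuous_const.mul (hθ.comp continuous_fst))).mul (continuous_subtype_val.comp continuous_snd))
  have h := continuous_parametric_integral_of_continuous (μ := μK) hcont isCompact_univ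
  simp only [Measure.restrict_univ] at h
  exact h

/-- **The line profile is Borel measurable** (from ★ `continuous_lineProfile_two`) — the measurability input of ★ (C-P)_two
`exists_push_and_integral_tsum_comp_ideleRelNorm_diagUnitZero_eq_two`. [cite: Rogawski1990, §7.3 (pp. 96–98)] -/
theorem measurable_lineProfile_two [MeasurableSpace (AdeleRing (𝓞 F) F)ˣ] [BorelSpace (AdeleRing (𝓞 F) F)ˣ]
    (hcδ : c δ = -δ) (hδ : δ ≠ 0) (z₁ : (quasiSplit F E c 2).arithmeticSubgroup)
    {f : (quasiSplit F E c 2).Adelic → ℂ} (hf : Continuous f) :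
    Measurable fun y : (AdeleRing (𝓞 F) F)ˣ => ∫ k, f ((k : (quasiSplit F E c 2).Adelic)⁻¹ *
      ((z₁ : (quasiSplit F E c 2).Adelic) *
        ((middleRootUnipotent hij hN (Multiplicative.ofAdd
            (traceZeroLine F E c hcδ hδ (((y⁻¹ : (AdeleRing (𝓞 F) F)ˣ)) : AdeleRing (𝓞 F) F))) :
          adelicUnipotent F E c 2) : (quasiSplit F E c 2).Adelic)) * (k : (quasiSplit F E c 2).Adelic)) ∂μK :=
  (continuous_lineProfile_two hij hN μK hcδ hδ z₁ hf).measurable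

end KAverage

end UnitaryGroup

end Literature.NumberTheory.Automorphic

end
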